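import Summits.BirchSwinnertonDyer.BirchSwinnertonDyer.Theorems.ManinLocalTwoThreeParOddExactOfFacts
import Summits.BirchSwinnertonDyer.BirchSwinnertonDyer.Theorems.ManinLocalTwoThreeParOddTwoOfDescent
import HarnessLib

/-!
# The `C₃`-image residual (`stub_cThreeImageResidual`) modulo the index-2 descent and the named leaves / facts

Summit `BirchSwinnertonDyer`, route `ManinLocalTwoThree` (cell bsd-f2-manin), crux C2 `ManinOddAtFour` (stmt-BirchSwinnertonDyer-22967),
line `kato_shift_two` v6, registered stub 3 `stub_cThreeImageResidual` (the 3 950 `C₃`-image classes).  End of the MEMO-es §25 chain on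
seat p3's side:

* `relativeIharaShiftVanishingParOdd_two_two_of_descent₂` — twin of the landed `…_of_descent` with the descent hypothesis for
  `j ≥ 2` ONLY (`2 ≤ j →`, the lead's 05:46:40Z shape `shiftInvariantDescentTwo_two_of_two_le`); `j = 1` is the vertex.
* **`multiShiftClassGenerationTwo_of_descent₂_and_facts`** — E-es-22 `MultiShiftClassGenerationTwo` from: the body of es's E-es-37
  `ShiftInvariantDescentTwo 2` restricted to `2 ≤ j` (index-2 descent, the lead's lane), the Literature facts F-es-27′
  `sl2ZModOddPrime_existsUnique_extension_of_stable_character` and E-es-43 `gamma0Away_character_extension_of_shiftInvariant`, and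
  the Chebotarev leaves E-es-40₂ / E-es-40 (`NotTrivialEisensteinOfIrreducibleAtTwo`, `NotTrivialEisensteinOfIrreducibleTwo`).
* **`cThreeImageResidual_of_descent₂_and_facts`** — the registered signature of `stub_cThreeImageResidual` VERBATIM (its Eisenstein
  hypothesis is not even used) from the same five inputs: the lead closes stub 3 by `exact cThreeImageResidual_of_descent₂_and_facts
  shiftInvariantDescentTwo_two_of_two_le h27 h43 hNT2 hNT` once E-es-37 (`j ≥ 2`, the lead's shape) is a theorem.

No new definitions; nothing about BSD or Manin's conjecture is proved here (five named inputs remain hypotheses: one descent step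
being proved in the cell, two Literature facts, two Chebotarev leaves).
-/

set_option autoImplicit false
set_option linter.dupNamespace false

noncomputable section

open scoped MatrixGroups

open CongruenceSubgroup Literature.NumberTheory.EllipticCurves.ModularForms
  Literature.NumberTheory.EllipticCurves.ModularForms.HidaCohomology
  Summit.BirchSwinnertonDyer.BirchSwinnertonDyer.Theorems.ConjSpanGenAllLevels
  Summit.BirchSwinnertonDyer.Rank1Residual.ManinAdditive
  Literature.NumberTheory.EllipticCurves Literature.GroupTheory.SpecificGroups

namespace Summit.BirchSwinnertonDyer.BirchSwinnertonDyer.Theorems.ManinLocalTwoThree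

/-- **E-es-36o at `(2,2,n)` from E-es-43 and the descent for `j ≥ 2` ONLY** (twin of `relativeIharaShiftVanishingParOdd_two_two_of_descent`
whose descent hypothesis reads `2 ≤ j →` — the shape the lead delivers as `shiftInvariantDescentTwo_two_of_two_le`; the `j = 1` step
is the vertex, done here without E-es-37): write `L = L′·2^k`
with `L′` odd; `oddShiftReduction` makes the class `2`-shift-invariant; for `k ≥ 2` descend (E-es-37) — the class is the
restriction of a class one level down with the same properties; at `k = 1` the vertex (`shiftInvariantIsOldUpToDiamondMin_two`,
`atkinLehnerStep_holds`, E-es-43, `eq_zero_of_vertexInputs_of_killsCusps`); at `k = 0` E-es-43 alone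
(`eq_zero_of_deltaCharacterExtension_of_not_dvd_of_killsCusps`). [cite: Shimura1971, §8.3 (8.3.2)] -/
theorem relativeIharaShiftVanishingParOdd_two_two_of_descent₂
    (h43 : gamma0Away_character_extension_of_shiftInvariant)
    (h37 : ∀ (K : Type) [Field K] [CharP K 2] (L' j : ℕ) [NeZero L'], ¬ 2 ∣ L' → 2 ≤ j →
      ∀ (S : Finset ℕ) (lam : ℕ → K) (u : cocycles 0 (L' * 2 ^ j) K),
        (∀ q : ℕ, q.Prime → q ∣ 2 * 2 * L' → q ∈ S) →
        IsHeckeGenEigenvector S lam u →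
        (∀ M : ℕ, ∃ r : ℕ, r.Prime ∧ r ∉ S ∧ r ≡ 1 [MOD 2 ^ M] ∧ lam r ≠ (r : K) + 1) →
        ((∀ γ : Gamma0 (L' * 2 ^ j), Matrix.SpecialLinearGroup.mapGL ℚ (γ : SL(2, ℤ)) • (OnePoint.infty : OnePoint ℚ) =
              OnePoint.infty → (u : Gamma0 (L' * 2 ^ j) → Fin 1 → K) γ = 0) ∧
          (∀ γ : Gamma0 (L' * 2 ^ j), Matrix.SpecialLinearGroup.mapGL ℚ (γ : SL(2, ℤ)) • ((0 : ℚ) : OnePoint ℚ) =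
              ((0 : ℚ) : OnePoint ℚ) → (u : Gamma0 (L' * 2 ^ j) → Fin 1 → K) γ = 0)) →
        degeneracyPullback 0 (L' * 2 ^ j) (L' * 2 ^ j * 2) 2 K dvd_rfl (u : Gamma0 (L' * 2 ^ j) → Fin 1 → K) =
          degeneracyPullback 0 (L' * 2 ^ j) (L' * 2 ^ j * 2) 1 K (by simp) (u : Gamma0 (L' * 2 ^ j) → Fin 1 → K) →
        ∃! u' : cocycles 0 (L' * 2 ^ (j - 1)) K,
          degeneracyPullback 0 (L' * 2 ^ (j - 1)) (L' * 2 ^ j) 1 K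
              (by rw [mul_one]; exact Nat.mul_dvd_mul_left L' (Nat.pow_dvd_pow 2 (Nat.sub_le j 1)))
              (u' : Gamma0 (L' * 2 ^ (j - 1)) → Fin 1 → K) = (u : Gamma0 (L' * 2 ^ j) → Fin 1 → K) ∧
          degeneracyPullback 0 (L' * 2 ^ (j - 1)) (L' * 2 ^ (j - 1) * 2) 2 K dvd_rfl
              (u' : Gamma0 (L' * 2 ^ (j - 1)) → Fin 1 → K) =
            degeneracyPullback 0 (L' * 2 ^ (j - 1)) (L' * 2 ^ (j - 1) * 2) 1 K (by simp)
              (u' : Gamma0 (L' * 2 ^ (j - 1)) → Fin 1 → K) ∧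
          IsHeckeGenEigenvector S lam u' ∧
          ((∀ γ : Gamma0 (L' * 2 ^ (j - 1)), Matrix.SpecialLinearGroup.mapGL ℚ (γ : SL(2, ℤ)) • (OnePoint.infty : OnePoint ℚ) =
                OnePoint.infty → (u' : Gamma0 (L' * 2 ^ (j - 1)) → Fin 1 → K) γ = 0) ∧
            (∀ γ : Gamma0 (L' * 2 ^ (j - 1)), Matrix.SpecialLinearGroup.mapGL ℚ (γ : SL(2, ℤ)) • ((0 : ℚ) : OnePoint ℚ) =
                ((0 : ℚ) : OnePoint ℚ) → (u' : Gamma0 (L' * 2 ^ (j - 1)) → Fin 1 → K) γ = 0)))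
    (n : ℕ) : RelativeIharaShiftVanishingParOdd 2 2 n := by
  intro h2 _ hn K _ _ L _ _ S lam u hS hgen hNT hpar hshift
  classical
  -- `2ⁿ`-shift ⟹ `2`-shift
  have hshift1 := oddShiftReduction 2 2 n h2 h2 hn K L S lam u hS hgen hNT hshift
  -- `L = L′ · 2^k`, `L′` odd
  obtain ⟨k, L', hL', rfl⟩ : ∃ k L' : ℕ, ¬ 2 ∣ L' ∧ L = L' * 2 ^ k :=
    ⟨L.factorization 2, L / 2 ^ L.factorization 2, Nat.not_dvd_ordCompl Nat.prime_two (NeZero.ne L),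
      ((Nat.ordProj_mul_ordCompl_eq_self L 2).symm.trans (mul_comm _ _))⟩
  haveI : NeZero L' := ⟨fun h => NeZero.ne (L' * 2 ^ k) (by rw [h, zero_mul])⟩
  -- E-es-43 at `t = 2` in the `Delta`/`iota` spelling, any level prime to `2`
  have h43' : ∀ (M : ℕ) [NeZero M], ¬ 2 ∣ M → ∀ u₀ : cocycles 0 M K,
      degeneracyPullback 0 M (M * 2) 2 K dvd_rfl (u₀ : Gamma0 M → Fin 1 → K) =
        degeneracyPullback 0 M (M * 2) 1 K (by simp) (u₀ : Gamma0 M → Fin 1 → K) →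
      ∃ Φ : SL(2, Away 2) → K,
        (∀ g ∈ Delta 2 M, ∀ g' ∈ Delta 2 M, Φ (g * g') = Φ g + Φ g') ∧
        ∀ γ : Gamma0 M, Φ (iota 2 (γ : SL(2, ℤ))) = (u₀ : Gamma0 M → Fin 1 → K) γ 0 := by
    intro M _ hM u₀ hsh
    obtain ⟨Φ, hadd, hι⟩ := h43 2 h2 K M hM u₀ hsh
    exact ⟨Φ, fun g hg g' hg' => hadd g hg g' hg', hι⟩
  -- the statement at level `L′ · 2^k`, by induction on `k`, for all `S`, `λ`, `u` with the two cusp conditions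
  have main : ∀ (k : ℕ) (S : Finset ℕ) (lam : ℕ → K) (u : cocycles 0 (L' * 2 ^ k) K),
      (∀ q : ℕ, q.Prime → q ∣ 2 * 2 * (L' * 2 ^ k) → q ∈ S) →
      IsHeckeGenEigenvector S lam u →
      (∀ M : ℕ, ∃ r : ℕ, r.Prime ∧ r ∉ S ∧ r ≡ 1 [MOD 2 ^ M] ∧ lam r ≠ (r : K) + 1) →
      (∀ γ : Gamma0 (L' * 2 ^ k), Matrix.SpecialLinearGroup.mapGL ℚ (γ : SL(2, ℤ)) • (OnePoint.infty : OnePoint ℚ) =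
          OnePoint.infty → (u : Gamma0 (L' * 2 ^ k) → Fin 1 → K) γ = 0) →
      (∀ γ : Gamma0 (L' * 2 ^ k), Matrix.SpecialLinearGroup.mapGL ℚ (γ : SL(2, ℤ)) • ((0 : ℚ) : OnePoint ℚ) =
          ((0 : ℚ) : OnePoint ℚ) → (u : Gamma0 (L' * 2 ^ k) → Fin 1 → K) γ = 0) →
      degeneracyPullback 0 (L' * 2 ^ k) (L' * 2 ^ k * 2) 2 K dvd_rfl (u : Gamma0 (L' * 2 ^ k) → Fin 1 → K) =
        degeneracyPullback 0 (L' * 2 ^ k) (L' * 2 ^ k * 2) 1 K (by simp) (u : Gamma0 (L' * 2 ^ k) → Fin 1 → K) →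
      u = 0 := by
    intro k
    induction k with
    | zero =>
      intro S lam u hS hgen hNT hinf hzero hsh
      have hL0 : ¬ 2 ∣ L' * 2 ^ 0 := by simpa using hL'
      obtain ⟨r, hr, hrS, -, hne⟩ := hNT 0
      exact eq_zero_of_deltaCharacterExtension_of_not_dvd_of_killsCusps (t := 2) Nat.prime_two S lam u
        (fun q hq hqd => hS q hq (hqd.trans (Dvd.intro_left _ rfl))) hgen ⟨r, hr, hrS, hne⟩ hinf hzero hsh
        (h43' (L' * 2 ^ 0) hL0)
    | succ k ih =>
      intro S lam u hS hgen hNT hinf hzero hsh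
      rcases Nat.eq_zero_or_pos k with hk | hk
      · -- `k + 1 = 1`: the vertex
        subst hk
        have hS' : ∀ q : ℕ, q.Prime → q ∣ L' * 2 → q ∈ S :=
          fun q hq hqd => hS q hq (hqd.trans ⟨4, by ring⟩)
        have hS'' : ∀ q : ℕ, q.Prime → q ∣ 2 * 2 * L' → q ∈ S :=
          fun q hq hqd => hS q hq (hqd.trans ⟨2, by ring⟩)
        obtain ⟨r, hr, hrS, -, hne⟩ := hNT 0
        exact eq_zero_of_vertexInputs_of_killsCusps (t := 2) (L' := L') Nat.prime_two hL' S lam u hS' hgen ⟨r, hr, hrS, hne⟩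
          hinf hzero (shiftInvariantIsOldUpToDiamondMin_two (p := 2) (by decide) h2 h2 K L' hL' u hsh)
          (atkinLehnerStep_holds 2 2 h2 h2 K L' hL' S lam u hS'' hgen hNT ⟨hinf, hzero⟩ hsh) (h43' L' hL')
      · -- `k + 1 ≥ 2`: descend
        have hS'' : ∀ q : ℕ, q.Prime → q ∣ 2 * 2 * L' → q ∈ S :=
          fun q hq hqd => hS q hq (hqd.trans ⟨2 ^ (k + 1), by ring⟩)
        obtain ⟨u', ⟨hres, hsh', hgen', hinf', hzero'⟩, -⟩ :=
          h37 K L' (k + 1) hL' (Nat.succ_le_succ hk) S lam u hS'' hgen hNT ⟨hinf, hzero⟩ hsh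
        have hu' : u' = 0 :=
          ih S lam u' (fun q hq hqd => hS q hq (hqd.trans ⟨2, by ring⟩)) hgen' hNT hinf' hzero' hsh'
        apply Subtype.ext
        rw [← hres, hu']
        exact map_zero _
  exact main k S lam u hS hgen hNT (fun γ hγ => hpar γ _ hγ) (fun γ hγ => hpar γ _ hγ) hshift1

/-- **E-es-22 for every `W[2]`-irreducible class, modulo the descent E-es-37 and the named leaves/facts.** [cite: Shimura1971, §8.3 (8.3.2)] -/
theorem multiShiftClassGenerationTwo_of_descent₂_and_facts
    (h37 : ∀ (K : Type) [Field K] [CharP K 2] (L' j : ℕ) [NeZero L'], ¬ 2 ∣ L' → 2 ≤ j →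
      ∀ (S : Finset ℕ) (lam : ℕ → K) (u : cocycles 0 (L' * 2 ^ j) K),
        (∀ q : ℕ, q.Prime → q ∣ 2 * 2 * L' → q ∈ S) →
        IsHeckeGenEigenvector S lam u →
        (∀ M : ℕ, ∃ r : ℕ, r.Prime ∧ r ∉ S ∧ r ≡ 1 [MOD 2 ^ M] ∧ lam r ≠ (r : K) + 1) →
        ((∀ γ : Gamma0 (L' * 2 ^ j), Matrix.SpecialLinearGroup.mapGL ℚ (γ : SL(2, ℤ)) • (OnePoint.infty : OnePoint ℚ) =
              OnePoint.infty → (u : Gamma0 (L' * 2 ^ j) → Fin 1 → K) γ = 0) ∧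
          (∀ γ : Gamma0 (L' * 2 ^ j), Matrix.SpecialLinearGroup.mapGL ℚ (γ : SL(2, ℤ)) • ((0 : ℚ) : OnePoint ℚ) =
              ((0 : ℚ) : OnePoint ℚ) → (u : Gamma0 (L' * 2 ^ j) → Fin 1 → K) γ = 0)) →
        degeneracyPullback 0 (L' * 2 ^ j) (L' * 2 ^ j * 2) 2 K dvd_rfl (u : Gamma0 (L' * 2 ^ j) → Fin 1 → K) =
          degeneracyPullback 0 (L' * 2 ^ j) (L' * 2 ^ j * 2) 1 K (by simp) (u : Gamma0 (L' * 2 ^ j) → Fin 1 → K) →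
        ∃! u' : cocycles 0 (L' * 2 ^ (j - 1)) K,
          degeneracyPullback 0 (L' * 2 ^ (j - 1)) (L' * 2 ^ j) 1 K
              (by rw [mul_one]; exact Nat.mul_dvd_mul_left L' (Nat.pow_dvd_pow 2 (Nat.sub_le j 1)))
              (u' : Gamma0 (L' * 2 ^ (j - 1)) → Fin 1 → K) = (u : Gamma0 (L' * 2 ^ j) → Fin 1 → K) ∧
          degeneracyPullback 0 (L' * 2 ^ (j - 1)) (L' * 2 ^ (j - 1) * 2) 2 K dvd_rfl
              (u' : Gamma0 (L' * 2 ^ (j - 1)) → Fin 1 → K) =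
            degeneracyPullback 0 (L' * 2 ^ (j - 1)) (L' * 2 ^ (j - 1) * 2) 1 K (by simp)
              (u' : Gamma0 (L' * 2 ^ (j - 1)) → Fin 1 → K) ∧
          IsHeckeGenEigenvector S lam u' ∧
          ((∀ γ : Gamma0 (L' * 2 ^ (j - 1)), Matrix.SpecialLinearGroup.mapGL ℚ (γ : SL(2, ℤ)) • (OnePoint.infty : OnePoint ℚ) =
                OnePoint.infty → (u' : Gamma0 (L' * 2 ^ (j - 1)) → Fin 1 → K) γ = 0) ∧
            (∀ γ : Gamma0 (L' * 2 ^ (j - 1)), Matrix.SpecialLinearGroup.mapGL ℚ (γ : SL(2, ℤ)) • ((0 : ℚ) : OnePoint ℚ) =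
                ((0 : ℚ) : OnePoint ℚ) → (u' : Gamma0 (L' * 2 ^ (j - 1)) → Fin 1 → K) γ = 0)))
    (h27 : sl2ZModOddPrime_existsUnique_extension_of_stable_character)
    (h43 : gamma0Away_character_extension_of_shiftInvariant)
    (hNT2 : NotTrivialEisensteinOfIrreducibleAtTwo) (hNT : NotTrivialEisensteinOfIrreducibleTwo) :
    MultiShiftClassGenerationTwo :=
  multiShiftClassGenerationTwo_of_parOdd_facts (relativeIharaShiftVanishingParOdd_two_two_of_descent₂ h43 h37 3) h27 h43 hNT2 hNT

/-- **The registered stub `stub_cThreeImageResidual` (its signature verbatim), modulo the descent E-es-37 and the named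
leaves/facts** — the lead's closer is `exact cThreeImageResidual_of_descent₂_and_facts shiftInvariantDescentTwo_two_of_two_le h27 h43 hNT2 hNT`. [cite: Shimura1971, §8.3 (8.3.2)] -/
theorem cThreeImageResidual_of_descent₂_and_facts
    (h37 : ∀ (K : Type) [Field K] [CharP K 2] (L' j : ℕ) [NeZero L'], ¬ 2 ∣ L' → 2 ≤ j →
      ∀ (S : Finset ℕ) (lam : ℕ → K) (u : cocycles 0 (L' * 2 ^ j) K),
        (∀ q : ℕ, q.Prime → q ∣ 2 * 2 * L' → q ∈ S) →
        IsHeckeGenEigenvector S lam u →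
        (∀ M : ℕ, ∃ r : ℕ, r.Prime ∧ r ∉ S ∧ r ≡ 1 [MOD 2 ^ M] ∧ lam r ≠ (r : K) + 1) →
        ((∀ γ : Gamma0 (L' * 2 ^ j), Matrix.SpecialLinearGroup.mapGL ℚ (γ : SL(2, ℤ)) • (OnePoint.infty : OnePoint ℚ) =
              OnePoint.infty → (u : Gamma0 (L' * 2 ^ j) → Fin 1 → K) γ = 0) ∧
          (∀ γ : Gamma0 (L' * 2 ^ j), Matrix.SpecialLinearGroup.mapGL ℚ (γ : SL(2, ℤ)) • ((0 : ℚ) : OnePoint ℚ) =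
              ((0 : ℚ) : OnePoint ℚ) → (u : Gamma0 (L' * 2 ^ j) → Fin 1 → K) γ = 0)) →
        degeneracyPullback 0 (L' * 2 ^ j) (L' * 2 ^ j * 2) 2 K dvd_rfl (u : Gamma0 (L' * 2 ^ j) → Fin 1 → K) =
          degeneracyPullback 0 (L' * 2 ^ j) (L' * 2 ^ j * 2) 1 K (by simp) (u : Gamma0 (L' * 2 ^ j) → Fin 1 → K) →
        ∃! u' : cocycles 0 (L' * 2 ^ (j - 1)) K,
          degeneracyPullback 0 (L' * 2 ^ (j - 1)) (L' * 2 ^ j) 1 K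
              (by rw [mul_one]; exact Nat.mul_dvd_mul_left L' (Nat.pow_dvd_pow 2 (Nat.sub_le j 1)))
              (u' : Gamma0 (L' * 2 ^ (j - 1)) → Fin 1 → K) = (u : Gamma0 (L' * 2 ^ j) → Fin 1 → K) ∧
          degeneracyPullback 0 (L' * 2 ^ (j - 1)) (L' * 2 ^ (j - 1) * 2) 2 K dvd_rfl
              (u' : Gamma0 (L' * 2 ^ (j - 1)) → Fin 1 → K) =
            degeneracyPullback 0 (L' * 2 ^ (j - 1)) (L' * 2 ^ (j - 1) * 2) 1 K (by simp)
              (u' : Gamma0 (L' * 2 ^ (j - 1)) → Fin 1 → K) ∧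
          IsHeckeGenEigenvector S lam u' ∧
          ((∀ γ : Gamma0 (L' * 2 ^ (j - 1)), Matrix.SpecialLinearGroup.mapGL ℚ (γ : SL(2, ℤ)) • (OnePoint.infty : OnePoint ℚ) =
                OnePoint.infty → (u' : Gamma0 (L' * 2 ^ (j - 1)) → Fin 1 → K) γ = 0) ∧
            (∀ γ : Gamma0 (L' * 2 ^ (j - 1)), Matrix.SpecialLinearGroup.mapGL ℚ (γ : SL(2, ℤ)) • ((0 : ℚ) : OnePoint ℚ) =
                ((0 : ℚ) : OnePoint ℚ) → (u' : Gamma0 (L' * 2 ^ (j - 1)) → Fin 1 → K) γ = 0)))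
    (h27 : sl2ZModOddPrime_existsUnique_extension_of_stable_character)
    (h43 : gamma0Away_character_extension_of_shiftInvariant)
    (hNT2 : NotTrivialEisensteinOfIrreducibleAtTwo) (hNT : NotTrivialEisensteinOfIrreducibleTwo) :
    ∀ (W : WeierstrassCurve ℚ) [W.IsElliptic] {N : ℕ} [NeZero N] (f : CuspForm (Gamma0 N) 2),
      IsNewformOf W f → 2 ^ 2 ∣ N → W.HasIrreducibleModPGaloisRep 2 →
      IsEisensteinEigensystem 2
        (fun ℓ : ℕ => algebraMap (ZMod 2) (AlgebraicClosure (ZMod 2)) ((W.LFunction ℓ : ℤ) : ZMod 2)) →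
      ∀ φ : ↥(periodLattice f) →+ ZMod 2,
        (∀ x : ↥(periodLattice f), (x : ℂ) ∈
            periodLattice (∑ T ∈ (insert 8 (N.primeFactors.filter fun q => ¬ q ^ 2 ∣ N)).powerset,
              (-1 : ℂ) ^ T.card • degeneracyMap0 N (8 * N ^ 2) (∏ t ∈ T, t - 1 + 1) 2 f) → φ x = 0) →
        φ = 0 := by
  intro W _ N _ f hf h4 hirr _ φ hφ
  exact (multiShiftClassGenerationTwo_iff_functionals.mp
    (multiShiftClassGenerationTwo_of_descent₂_and_facts h37 h27 h43 hNT2 hNT)) W f hf h4 hirr φ hφ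

end Summit.BirchSwinnertonDyer.BirchSwinnertonDyer.Theorems.ManinLocalTwoThree

end
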